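import Summits.KontsevichZagierPeriods.KontsevichZagierPeriods.Theses.ZeroPortrait
import Summits.KontsevichZagierPeriods.KontsevichZagierPeriods.Theorems.NegTriplicationValueEq
import Literature.Analysis.SpecialFunctions.LemniscaticEllipticValuesProofs

/-!
# `BetaPortrait` (stmt-KontsevichZagierPeriods-11728, route ZeroPortrait) — proof

For rational `s > 0`, let `r` be an integral representation on the open unit square `(0,1)²`
with the beta-pencil integrand `x^{s-1}(1-x)^{-5/9} · y^{-4/9}(1-y)^{-2/9}`, and let `r'` be a
representation on the open disc `{x² + y² < 4}` with the constant integrand `3^{7/6}/2`.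
If `r.value = r'.value`, then `s = 1/9`.

Proof. Tonelli on the square gives `r.value = F(s) · C` with
`F(a) = ∫_{(0,1)} u^{a-1}(1-u)^{-5/9} du` (`= B(a, 4/9)`) and
`C = ∫_{(0,1)} u^{-4/9}(1-u)^{-2/9} du = Γ(5/9)Γ(7/9)/Γ(4/3) > 0`; the disc gives
`r'.value = 4π · 3^{7/6}/2` (`Neg.neg_triplication_value_disc`), which by Gauss's triplication
formula at `1/9` (`Neg.neg_triplication_gamma_identity`, the value identity of route Neg's
`TriplicationValueEq`) equals `F(1/9) · C`. The map `F` is strictly decreasing on `(0, ∞)`: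
for `0 < a < b` and `u ∈ (0,1)` one has `u^{b-1} < u^{a-1}`, both integrands being integrable
(Euler's Beta integral), so the difference has positive integral. Hence `F` is injective on
`(0, ∞)` and `F(s) · C = F(1/9) · C` forces `s = 1/9`.

References: M. Kontsevich, D. Zagier, *Periods* (2001), §1.1; G. E. Andrews, R. Askey, R. Roy,
*Special Functions* (1999), Thm 1.1.4 (Beta integral), Thm 1.5.2 (Gauss multiplication).
-/

namespace Summit.KontsevichZagierPeriods.ZeroPortrait

open MeasureTheory Set

/-- Integrability of the first beta-pencil factor `u ↦ u^{a-1}(1-u)^{-5/9}` on `(0,1)` for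
`a > 0` (Euler's Beta integral `B(a, 4/9)` converges absolutely). [folklore] -/
theorem betaPortrait_integrableOn_factor {a : ℝ} (ha : 0 < a) :
    IntegrableOn (fun u : ℝ => u ^ (a - 1) * (1 - u) ^ (-(5:ℝ)/9)) (Ioo 0 1) := by
  have h := Literature.Analysis.SpecialFunctions.integrableOn_Ioo_rpow_mul_one_sub_rpow
    (a := a) (b := (4:ℝ)/9) ha (by norm_num)
  rw [show (4:ℝ)/9 - 1 = -(5:ℝ)/9 by norm_num] at h
  exact h

/-- For `0 < a < b` the beta-pencil integrands compare strictly pointwise on `(0,1)`: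
`u^{b-1}(1-u)^{-5/9} < u^{a-1}(1-u)^{-5/9}`, since `u ↦ u^t` is strictly decreasing in the
exponent for a base `0 < u < 1`. [folklore] -/
theorem betaPortrait_integrand_lt {a b : ℝ} (hab : a < b) {u : ℝ} (hu : u ∈ Ioo (0:ℝ) 1) :
    u ^ (b - 1) * (1 - u) ^ (-(5:ℝ)/9) < u ^ (a - 1) * (1 - u) ^ (-(5:ℝ)/9) := by
  have hc : 0 < (1 - u) ^ (-(5:ℝ)/9) := Real.rpow_pos_of_pos (by linarith [hu.2]) _
  exact mul_lt_mul_of_pos_right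
    (Real.rpow_lt_rpow_of_exponent_gt hu.1 hu.2 (by linarith)) hc

/-- **The first beta-pencil factor is strictly decreasing.** The map
`a ↦ ∫_{(0,1)} u^{a-1}(1-u)^{-5/9} du = B(a, 4/9)` is strictly antitone on `(0, ∞)`: for
`0 < a < b` the difference of the integrands is integrable, nonnegative, and positive on all of
`(0,1)`, a set of Lebesgue measure `1 > 0`, so its integral is positive. [folklore] -/
theorem betaPortrait_factor_strictAntiOn :
    StrictAntiOn (fun a : ℝ => ∫ u in Ioo (0:ℝ) 1, u ^ (a - 1) * (1 - u) ^ (-(5:ℝ)/9))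
      (Ioi 0) := by
  intro a ha b hb hab
  have hia := betaPortrait_integrableOn_factor (a := a) ha
  have hib := betaPortrait_integrableOn_factor (a := b) hb
  have hpos : 0 < ∫ u in Ioo (0:ℝ) 1,
      (u ^ (a - 1) * (1 - u) ^ (-(5:ℝ)/9) - u ^ (b - 1) * (1 - u) ^ (-(5:ℝ)/9)) := by
    rw [setIntegral_pos_iff_support_of_nonneg_ae]
    · have hsub : Ioo (0:ℝ) 1 ⊆ Function.support (fun u : ℝ =>
          u ^ (a - 1) * (1 - u) ^ (-(5:ℝ)/9) - u ^ (b - 1) * (1 - u) ^ (-(5:ℝ)/9)) :=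
        fun u hu => Function.mem_support.2 (sub_pos.2 (betaPortrait_integrand_lt hab hu)).ne'
      rw [inter_eq_self_of_subset_right hsub, Real.volume_Ioo]
      exact ENNReal.ofReal_pos.2 (by norm_num)
    · filter_upwards [ae_restrict_mem measurableSet_Ioo] with u hu
      exact (sub_pos.2 (betaPortrait_integrand_lt hab hu)).le
    · exact hia.sub hib
  rw [integral_sub hia hib] at hpos
  exact sub_pos.1 hpos

/-- **Tonelli on the open unit square.** The value of any representation `r` with domain
`(0,1)²` and the product integrand `x^{t}(1-x)^{-5/9} · y^{-4/9}(1-y)^{-2/9}` is the product of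
the two one-dimensional integrals over `(0,1)` (`MeasureTheory.volume_pi`,
`MeasureTheory.Measure.restrict_pi_pi`, `MeasureTheory.integral_fintype_prod_eq_prod`; no
integrability is needed for this identity). [folklore] -/
theorem betaPortrait_value_square (t : ℝ)
    (r : Literature.NumberTheory.Transcendental.KZ.IntegralRep 2)
    (hd : r.domain = {x | ∀ i, x i ∈ Set.Ioo (0:ℝ) 1})
    (hf : Set.EqOn r.integrand (fun x => (x 0) ^ t * (1 - x 0) ^ (-(5:ℝ)/9) *
      (x 1) ^ (-(4:ℝ)/9) * (1 - x 1) ^ (-(2:ℝ)/9)) r.domain) :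
    r.value = (∫ u in Ioo (0:ℝ) 1, u ^ t * (1 - u) ^ (-(5:ℝ)/9)) *
      (∫ u in Ioo (0:ℝ) 1, u ^ (-(4:ℝ)/9) * (1 - u) ^ (-(2:ℝ)/9)) := by
  unfold Literature.NumberTheory.Transcendental.KZ.IntegralRep.value
  have hS : ({x | ∀ i, x i ∈ Set.Ioo (0:ℝ) 1} : Set (Fin 2 → ℝ)) =
      Set.pi Set.univ (fun _ => Set.Ioo (0:ℝ) 1) := by
    ext x
    simp
  have hm : MeasurableSet r.domain := by
    rw [hd, hS]
    exact MeasurableSet.univ_pi (fun _ => measurableSet_Ioo)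
  rw [setIntegral_congr_fun hm hf, hd, hS, volume_pi, Measure.restrict_pi_pi]
  have hprod : (fun x : Fin 2 → ℝ => (x 0) ^ t * (1 - x 0) ^ (-(5:ℝ)/9) *
      (x 1) ^ (-(4:ℝ)/9) * (1 - x 1) ^ (-(2:ℝ)/9)) =
      fun x => ∏ i, (![fun u : ℝ => u ^ t * (1 - u) ^ (-(5:ℝ)/9),
        fun u : ℝ => u ^ (-(4:ℝ)/9) * (1 - u) ^ (-(2:ℝ)/9)] i) (x i) := by
    funext x
    rw [Fin.prod_univ_two]
    simp only [Matrix.cons_val_zero, Matrix.cons_val_one]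
    ring
  rw [hprod, integral_fintype_prod_eq_prod, Fin.prod_univ_two]
  simp only [Matrix.cons_val_zero, Matrix.cons_val_one]

/-- The second beta-pencil factor is positive:
`∫_{(0,1)} u^{-4/9}(1-u)^{-2/9} du = Γ(5/9)Γ(7/9)/Γ(4/3) > 0`. [folklore] -/
theorem betaPortrait_second_factor_pos :
    0 < ∫ u in Ioo (0:ℝ) 1, u ^ (-(4:ℝ)/9) * (1 - u) ^ (-(2:ℝ)/9) := by
  rw [Summit.KontsevichZagierPeriods.Neg.neg_triplication_beta_two]
  exact div_pos (mul_pos (Real.Gamma_pos_of_pos (by norm_num))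
    (Real.Gamma_pos_of_pos (by norm_num))) (Real.Gamma_pos_of_pos (by norm_num))

/-- The disc side in beta form: the value of any representation `r'` with domain the open disc
`{x² + y² < 4}` and constant integrand `3^{7/6}/2` is `4π · 3^{7/6}/2 = B(1/9,4/9) · B(5/9,7/9)`,
i.e. the beta-pencil product at `s = 1/9` (Gauss triplication at `1/9`, route Neg's
`TriplicationValueEq`). [cite: AndrewsAskeyRoy1999, Thm 1.5.2] -/
theorem betaPortrait_value_disc
    (r' : Literature.NumberTheory.Transcendental.KZ.IntegralRep 2)
    (hd' : r'.domain = {x | x 0 ^ 2 + x 1 ^ 2 < 4})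
    (hf' : Set.EqOn r'.integrand (fun _ => (3:ℝ) ^ ((7:ℝ)/6) / 2) r'.domain) :
    r'.value = (∫ u in Ioo (0:ℝ) 1, u ^ ((1:ℝ)/9 - 1) * (1 - u) ^ (-(5:ℝ)/9)) *
      (∫ u in Ioo (0:ℝ) 1, u ^ (-(4:ℝ)/9) * (1 - u) ^ (-(2:ℝ)/9)) := by
  rw [Summit.KontsevichZagierPeriods.Neg.neg_triplication_value_disc r' hd' hf',
    ← Summit.KontsevichZagierPeriods.Neg.neg_triplication_gamma_identity,
    ← Summit.KontsevichZagierPeriods.Neg.neg_triplication_beta_one,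
    ← Summit.KontsevichZagierPeriods.Neg.neg_triplication_beta_two,
    show (1:ℝ)/9 - 1 = -(8:ℝ)/9 by norm_num]

/-- **`BetaPortrait`** (route ZeroPortrait, stmt-KontsevichZagierPeriods-11728): for rational
`s > 0`, if the beta-pencil representation `[(0,1)², x^{s-1}(1-x)^{-5/9} y^{-4/9}(1-y)^{-2/9}]`
has the same value as `[{x² + y² < 4}, 3^{7/6}/2]`, then `s = 1/9`. Proof: both values are
`F(·) · C` with `C = B(5/9,7/9) > 0`, at the exponents `s` and `1/9` respectively (Tonelli, and
Gauss triplication for the disc), and `F(a) = B(a,4/9)` is strictly decreasing, hence injective,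
on `(0, ∞)`. [folklore] -/
theorem betaPortrait_proof :
    Summit.KontsevichZagierPeriods.KontsevichZagierPeriods.Theses.ZeroPortrait.BetaPortrait := by
  unfold Summit.KontsevichZagierPeriods.KontsevichZagierPeriods.Theses.ZeroPortrait.BetaPortrait
  intro s hs r r' hd hf hd' hf' hv
  have hr := betaPortrait_value_square ((s:ℝ) - 1) r hd hf
  rw [hv, betaPortrait_value_disc r' hd' hf'] at hr
  have heq := mul_right_cancel₀ betaPortrait_second_factor_pos.ne' hr
  have hs' : (1:ℝ)/9 = (s:ℝ) :=
    betaPortrait_factor_strictAntiOn.injOn (Set.mem_Ioi.2 (by norm_num : (0:ℝ) < 1/9))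
      (Set.mem_Ioi.2 (by exact_mod_cast hs : (0:ℝ) < s)) heq
  have h9 : ((1 / 9 : ℚ) : ℝ) = 1 / 9 := by norm_num
  exact Rat.cast_injective (hs'.symm.trans h9.symm)

end Summit.KontsevichZagierPeriods.ZeroPortrait
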